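import Summits.MatrixMultiplication.MatrixMultiplication.Theorems.NilpotentLieHostsUnitriangularCostShapeModelLevels

/-!
# `UnitriangularCostShape` — Product model, part 6: the graded family of a level and the row expansion

Crux `stmt-MatrixMultiplication-7724` (`NilpotentLieHosts.UnitriangularCostShape`), line `registered`
(`Cruxes/UnitriangularCostShape/Lines/birth.lean`), stub `stub_productModel` (the Weyl-type product model of
`U(u_d)/I^(s+1)` over the truncated Casimir algebra, `b = k = ⌊d/2⌋`).  Helper vocabulary and lemmas, namespace
`…Theorems.UnitriangularCostShape.ProductModel`.

The graded family `GR j`, memberships of the level pieces `Aterm`, `Rterm` (`σ(v_u) = A_u + R_u`), row budgets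
`RowLe`/`RowLt`, the binomial and product expansions with row budget.
-/

set_option linter.dupNamespace false

noncomputable section

namespace Summit.MatrixMultiplication.MatrixMultiplication.Theorems.UnitriangularCostShape.ProductModel

open MvPolynomial
open scoped BigOperators Pointwise

variable {d : ℕ}

/-- The graded family of level `j`: weight balance with shift `cn.1`, block support, column-`j`
`v`-variables, and row-degree `≤ cn.2`. -/
def GR (j : Fin d) (cn : ℕ × ℕ) : Set ((Fin d × Fin d →₀ ℕ) × (Var d →₀ ℕ)) :=
  {x | Finsupp.weight xw x.1 + cn.1 = Finsupp.weight Var.wt x.2 ∧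
    (∀ p ∈ x.1.support, lo j ≤ p.1 ∧ p.1 < p.2 ∧ p.2 ≤ j) ∧
    (∀ u ∈ x.2.support, u.col = j) ∧ rhoL j x.1 ≤ cn.2}

/-- The level family is additive. -/
theorem gr_add (j : Fin d) : ∀ (a b : ℕ × ℕ) x y, x ∈ GR (d := d) j a → y ∈ GR j b →
    x + y ∈ GR j (a + b) := by
  classical
  rintro a b x y ⟨hx1, hx2, hx3, hx4⟩ ⟨hy1, hy2, hy3, hy4⟩
  refine ⟨?_, ?_, ?_, ?_⟩
  · simp only [Prod.fst_add, Prod.snd_add, map_add]; omega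
  · intro p hp
    simp only [Prod.fst_add] at hp
    rcases Finset.mem_union.mp (Finsupp.support_add hp) with h | h
    · exact hx2 p h
    · exact hy2 p h
  · intro u hu
    simp only [Prod.snd_add] at hu
    rcases Finset.mem_union.mp (Finsupp.support_add hu) with h | h
    · exact hx3 u h
    · exact hy3 u h
  · simp only [Prod.fst_add, Prod.snd_add, rhoL_add]; omega

/-- `0` lies in the level family at `(0, 0)`. -/
theorem zero_mem_gr (j : Fin d) : (0 : (Fin d × Fin d →₀ ℕ) × (Var d →₀ ℕ)) ∈ GR j 0 := by
  refine ⟨by simp, ?_, ?_, by simp⟩ <;> intro _ h <;> simp at h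

/-- The level family is monotone in the row budget. -/
theorem gr_mono (j : Fin d) {c n n' : ℕ} (h : n ≤ n') : GR (d := d) j (c, n) ⊆ GR j (c, n') :=
  fun _ hx => ⟨hx.1, hx.2.1, hx.2.2.1, hx.2.2.2.trans h⟩

/-- Row-degree of a single position is at most one. -/
theorem rhoL_single_le (j : Fin d) (p : Fin d × Fin d) : rhoL j (Finsupp.single p 1) ≤ 1 := by
  classical
  unfold rhoL
  by_cases h : ∃ u : Var d, u.col = j ∧ lo j < u.row ∧ ((lo j, u.row) : Fin d × Fin d) = p
  · obtain ⟨u, hu1, hu2, hu3⟩ := h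
    rw [Finset.sum_eq_single u]
    · rw [if_pos ⟨hu1, hu2⟩, ← hu3, Finsupp.single_eq_same]
    · intro u' _ hu'
      split_ifs with h'
      · rw [Finsupp.single_apply, if_neg]
        intro h''
        apply hu'
        apply Subtype.ext
        have : u'.row = u.row := by
          have := congrArg Prod.snd (h''.symm.trans hu3.symm); simpa using this
        exact Prod.ext this (h'.1.trans hu1.symm)
      · rfl
    · intro h; exact absurd (Finset.mem_univ u) h
  · push Not at h
    rw [Finset.sum_eq_zero]
    · exact Nat.zero_le _
    · intro u _
      split_ifs with h'
      · rw [Finsupp.single_apply, if_neg]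
        intro h''
        exact h u h'.1 h'.2 h''.symm
      · rfl

/-- Positions outside row `lo j` have row-degree `0`. -/
theorem rhoL_single_eq_zero (j : Fin d) {p : Fin d × Fin d} (hp : p.1 ≠ lo j) :
    rhoL j (Finsupp.single p 1) = 0 := by
  classical
  unfold rhoL
  refine Finset.sum_eq_zero fun u _ => ?_
  split_ifs
  · rw [Finsupp.single_apply, if_neg]
    intro h; apply hp; rw [h]
  · rfl

/-- Positions in column `j` have row-degree `0` at level `j`. -/
theorem rhoL_single_eq_zero' (j : Fin d) {p : Fin d × Fin d} (hp : p.2 = j) :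
    rhoL j (Finsupp.single p 1) = 0 := by
  classical
  unfold rhoL
  refine Finset.sum_eq_zero fun u _ => ?_
  split_ifs with h'
  · rw [Finsupp.single_apply, if_neg]
    intro h
    have h1 := u.row_lt_col
    rw [h'.1] at h1
    have h2 : p.2 = u.row := by rw [h]
    rw [hp] at h2
    rw [← h2] at h1
    exact lt_irrefl _ h1
  · rfl

/-- A pair of unit vectors lies in the level family under the expected conditions. -/
theorem single_single_mem_gr (j : Fin d) {p : Fin d × Fin d} {u : Var d} {c n : ℕ}
    (hw : xw p + c = u.wt) (hb : lo j ≤ p.1 ∧ p.1 < p.2 ∧ p.2 ≤ j) (hu : u.col = j)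
    (hr : rhoL j (Finsupp.single p 1) ≤ n) :
    ((Finsupp.single p 1, Finsupp.single u 1) : (Fin d × Fin d →₀ ℕ) × (Var d →₀ ℕ)) ∈ GR j (c, n) := by
  classical
  refine ⟨by simpa [Finsupp.weight_single] using hw, ?_, ?_, hr⟩
  · intro p' hp'
    have : p' = p := by
      rw [Finsupp.mem_support_iff, Finsupp.single_apply] at hp'
      by_contra h; exact hp' (if_neg (Ne.symm h))
    rw [this]; exact hb
  · intro u' hu'
    have : u' = u := by
      rw [Finsupp.mem_support_iff, Finsupp.single_apply] at hu'
      by_contra h; exact hu' (if_neg (Ne.symm h))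
    rw [this]; exact hu

/-- A bare `v`-variable of column `j` lies in the level family. -/
theorem zero_single_mem_gr (j : Fin d) {u : Var d} (hu : u.col = j) (n : ℕ) :
    ((0, Finsupp.single u 1) : (Fin d × Fin d →₀ ℕ) × (Var d →₀ ℕ)) ∈ GR j (u.wt, n) := by
  classical
  refine ⟨by simp [Finsupp.weight_single], ?_, ?_, by simp⟩
  · intro p hp; simp at hp
  · intro u' hu'
    have : u' = u := by
      rw [Finsupp.mem_support_iff, Finsupp.single_apply] at hu'
      by_contra h; exact hu' (if_neg (Ne.symm h))
    rw [this]; exact hu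

/-- Joint support of `x_p · v_u`. -/
theorem jsupp_CX_mul_X (p : Fin d × Fin d) (u : Var d) :
    JSupp (C (X p : A d) * X u : MvPolynomial (Var d) (A d)) ⊆ {(Finsupp.single p 1, Finsupp.single u 1)} := by
  classical
  intro x hx
  obtain ⟨y, hy, z, hz, rfl⟩ := Set.mem_add.mp (jsupp_mul _ _ hx)
  have hy' := jsupp_C (X p : A d) hy
  have hz' := jsupp_X u hz
  rw [Set.mem_singleton_iff] at hz' ⊢
  have h1 : y.1 = Finsupp.single p 1 := by
    have := hy'.2
    rw [MvPolynomial.support_X, Finset.mem_singleton] at this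
    exact this
  ext : 1
  · rw [Prod.fst_add, h1, hz']; simp
  · rw [Prod.snd_add, hy'.1, hz']; simp

/-- The exponential factor of a column-`j` variable lies in the family at `(0, 0)`. -/
theorem jsupp_expK_factor_subset_gr (K : ℕ) (j : Fin d) {u : Var d} (hu : u.col = j) :
    JSupp (expK K (C (Xmat d u.row u.col) * X u)) ⊆ GR j (0, 0) := by
  unfold expK
  refine jsupp_sum_subset _ _ fun k _ => (jsupp_smul _ _).trans ?_
  have h := jsupp_pow_subset (GR j) (gr_add j) (zero_mem_gr j) (a := (0, 0))
    ((jsupp_CX_mul_X (u.row, u.col) u).trans ?_) k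
  · have e : k • ((0, 0) : ℕ × ℕ) = (0, 0) := by ext <;> simp
    rw [e] at h
    exact h
  · intro x hx
    rw [Set.mem_singleton_iff] at hx
    rw [hx]
    refine single_single_mem_gr j ?_ ⟨?_, u.row_lt_col, le_of_eq hu⟩ hu ?_
    · simp [xw, Var.wt]
    · exact lo_le_row_of_col hu
    · rw [rhoL_single_eq_zero' j hu]

open MvPolynomial
open scoped BigOperators Pointwise

variable {d : ℕ}

/-- The row part of `σ(v_u)` at level `j`: `x_{(lo j, i)} · z_j` for `u = (i, j)`. -/
def Aterm (j : Fin d) (hj : d ≤ 2 * (j : ℕ)) (u : Var d) : MvPolynomial (Var d) (A d) :=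
  C (X (lo j, u.row) : A d) * X (zv j hj)

/-- The rest of `σ(v_u)` at level `j`: `v_u + Σ_{lo j < i' < i} x_{(i', i)} v_{(i', j)}`. -/
def Rterm (j : Fin d) (u : Var d) : MvPolynomial (Var d) (A d) :=
  X u + ∑ u' : Var d, if u'.col = j ∧ lo j < u'.row ∧ u'.row < u.row then
    C (X (u'.row, u.row) : A d) * X u' else 0

/-- The level decomposition `σ(v_u) = A_u + R_u` of a `q`-variable of column `j`. -/
theorem sigmaX_level (j : Fin d) (hj : d ≤ 2 * (j : ℕ)) {u : Var d} (hu : u.col = j)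
    (hq : lo j < u.row) : sigmaX (Xmat d) u = Aterm j hj u + Rterm j u := by
  classical
  unfold sigmaX Aterm Rterm
  have key : ∀ u' : Var d,
      (if u'.col = u.col ∧ u'.row < u.row then C (Xmat d u'.row u.row) * X u' else 0) =
      (if u' = zv j hj then C (X (lo j, u.row) : A d) * X (zv j hj) else 0) +
      (if u'.col = j ∧ lo j < u'.row ∧ u'.row < u.row then C (X (u'.row, u.row) : A d) * X u' else 0) := by
    intro u'
    by_cases h1 : u'.col = j
    · by_cases h2 : u'.row = lo j
      · have hz : u' = zv j hj := eq_zv_of_row_eq_lo hj h1 h2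
        subst hz
        simp only [zv_row, zv_col, lt_irrefl, false_and, and_false, if_false, add_zero, if_true, hu, hq,
          and_self]
        rfl
      · have hz : u' ≠ zv j hj := fun h => h2 (by rw [h]; rfl)
        have h3 : lo j < u'.row := lt_of_le_of_ne (lo_le_row_of_col h1) (Ne.symm h2)
        rw [if_neg hz, zero_add, hu]
        by_cases h4 : u'.row < u.row
        · rw [if_pos ⟨h1, h4⟩, if_pos ⟨h1, h3, h4⟩]; rfl
        · rw [if_neg (fun h => h4 h.2), if_neg (fun h => h4 h.2.2)]
    · have hz : u' ≠ zv j hj := fun h => h1 (by rw [h]; rfl)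
      rw [if_neg hz, zero_add, hu, if_neg (fun h => h1 h.1), if_neg (fun h => h1 h.1)]
  simp_rw [key]
  rw [Finset.sum_add_distrib, Finset.sum_ite_eq' Finset.univ (zv j hj), if_pos (Finset.mem_univ _)]
  ring

/-- `A_u` lies in the level family at `(wt u, 1)`. -/
theorem jsupp_Aterm (j : Fin d) (hj : d ≤ 2 * (j : ℕ)) {u : Var d} (hu : u.col = j) (hq : lo j < u.row) :
    JSupp (Aterm j hj u) ⊆ GR j (u.wt, 1) := by
  unfold Aterm
  refine (jsupp_CX_mul_X (lo j, u.row) (zv j hj)).trans ?_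
  intro x hx
  rw [Set.mem_singleton_iff] at hx
  rw [hx]
  have h1 : (lo j : ℕ) < u.row := hq
  have h2 : (u.row : ℕ) < j := hu ▸ (u.row_lt_col : (u.row : ℕ) < u.col)
  refine single_single_mem_gr j ?_ ⟨le_rfl, hq, ?_⟩ rfl (rhoL_single_le j _)
  · simp only [xw, Var.wt, zv_col, zv_row, hu]
    omega
  · exact (hu ▸ u.row_lt_col).le

/-- `R_u` lies in the level family at `(wt u, 0)`. -/
theorem jsupp_Rterm (j : Fin d) {u : Var d} (hu : u.col = j) : JSupp (Rterm j u) ⊆ GR j (u.wt, 0) := by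
  unfold Rterm
  refine (jsupp_add _ _).trans (Set.union_subset ?_ ?_)
  · refine (jsupp_X u).trans ?_
    intro x hx
    rw [Set.mem_singleton_iff] at hx
    rw [hx]
    exact zero_single_mem_gr j hu 0
  · refine jsupp_sum_subset _ _ fun u' _ => ?_
    split_ifs with h
    · refine (jsupp_CX_mul_X (u'.row, u.row) u').trans ?_
      intro x hx
      rw [Set.mem_singleton_iff] at hx
      rw [hx]
      have h1 : (lo j : ℕ) < u'.row := h.2.1
      have h2 : (u'.row : ℕ) < u.row := h.2.2
      have h3 : (u.row : ℕ) < j := hu ▸ (u.row_lt_col : (u.row : ℕ) < u.col)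
      refine single_single_mem_gr j ?_ ⟨h.2.1.le, h.2.2, (hu ▸ u.row_lt_col).le⟩ h.1 ?_
      · simp only [xw, Var.wt, h.1, hu]
        omega
      · rw [rhoL_single_eq_zero]
        exact ne_of_gt h.2.1
    · rw [jsupp_zero]; exact Set.empty_subset _

/-! ### Row budgets -/

/-- Row-degree at level `j` at most `n`. -/
def RowLe (j : Fin d) (n : ℕ) : Set ((Fin d × Fin d →₀ ℕ) × (Var d →₀ ℕ)) := {x | rhoL j x.1 ≤ n}

/-- Row-degree at level `j` less than `n`. -/
def RowLt (j : Fin d) (n : ℕ) : Set ((Fin d × Fin d →₀ ℕ) × (Var d →₀ ℕ)) := {x | rhoL j x.1 < n}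

/-- Row budgets are additive. -/
theorem rowLe_add (j : Fin d) : ∀ (a b : ℕ) x y, x ∈ RowLe (d := d) j a → y ∈ RowLe j b →
    x + y ∈ RowLe j (a + b) := by
  intro a b x y hx hy
  simp only [RowLe, Set.mem_setOf_eq, Prod.fst_add, rhoL_add] at hx hy ⊢
  omega

/-- `0` has every row budget. -/
theorem zero_mem_rowLe (j : Fin d) (n : ℕ) : (0 : (Fin d × Fin d →₀ ℕ) × (Var d →₀ ℕ)) ∈ RowLe j n := by
  simp [RowLe]

/-- The level family refines the row budget. -/
theorem gr_subset_rowLe (j : Fin d) (c n : ℕ) : GR (d := d) j (c, n) ⊆ RowLe j n :=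
  fun _ hx => hx.2.2.2

/-- Strict row budgets refine row budgets. -/
theorem rowLt_subset_rowLe (j : Fin d) (n : ℕ) : RowLt (d := d) j n ⊆ RowLe j n :=
  fun x hx => show rhoL j x.1 ≤ n from le_of_lt hx

/-- Row budget times strict row budget is strict. -/
theorem jsupp_mul_rowLe_rowLt (j : Fin d) {a b : ℕ} {P Q : MvPolynomial (Var d) (A d)}
    (hP : JSupp P ⊆ RowLe j a) (hQ : JSupp Q ⊆ RowLt j b) : JSupp (P * Q) ⊆ RowLt j (a + b) := by
  intro x hx
  obtain ⟨y, hy, z, hz, rfl⟩ := Set.mem_add.mp (jsupp_mul P Q hx)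
  have h1 := hP hy; have h2 := hQ hz
  simp only [RowLe, RowLt, Set.mem_setOf_eq, Prod.fst_add, rhoL_add] at h1 h2 ⊢
  omega

/-- Strict row budget times row budget is strict. -/
theorem jsupp_mul_rowLt_rowLe (j : Fin d) {a b : ℕ} {P Q : MvPolynomial (Var d) (A d)}
    (hP : JSupp P ⊆ RowLt j a) (hQ : JSupp Q ⊆ RowLe j b) : JSupp (P * Q) ⊆ RowLt j (a + b) := by
  intro x hx
  obtain ⟨y, hy, z, hz, rfl⟩ := Set.mem_add.mp (jsupp_mul P Q hx)
  have h1 := hP hy; have h2 := hQ hz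
  simp only [RowLe, RowLt, Set.mem_setOf_eq, Prod.fst_add, rhoL_add] at h1 h2 ⊢
  omega

/-- Natural-number constants have row budget `0`. -/
theorem jsupp_natCast (j : Fin d) (n : ℕ) : JSupp ((n : MvPolynomial (Var d) (A d))) ⊆ RowLe j 0 := by
  classical
  intro x hx
  rw [← map_natCast (C : A d →+* MvPolynomial (Var d) (A d)) n] at hx
  have := jsupp_C (n : A d) hx
  have h1 : x.1 = 0 := by
    have h := this.2
    rw [← map_natCast (C : ℂ →+* A d) n] at h
    by_contra h0
    rw [MvPolynomial.mem_support_iff, MvPolynomial.coeff_C, if_neg (Ne.symm h0)] at h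
    exact h rfl
  simp [RowLe, h1]

/-- Binomial expansion with row budget: `(P + Q)^e = P^e + L`, `L` of row-degree `< e`. -/
theorem binom_expand (j : Fin d) {P Q : MvPolynomial (Var d) (A d)} (hP : JSupp P ⊆ RowLe j 1)
    (hQ : JSupp Q ⊆ RowLe j 0) (e : ℕ) :
    ∃ L, (P + Q) ^ e = P ^ e + L ∧ JSupp L ⊆ RowLt j e := by
  refine ⟨∑ k ∈ Finset.range e, P ^ k * Q ^ (e - k) * (e.choose k : MvPolynomial (Var d) (A d)), ?_, ?_⟩
  · rw [add_pow, Finset.sum_range_succ, Nat.choose_self, Nat.cast_one, mul_one, Nat.sub_self, pow_zero,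
      mul_one, add_comm]
  · refine jsupp_sum_subset _ _ fun k hk => ?_
    rw [Finset.mem_range] at hk
    have h1 : JSupp (P ^ k) ⊆ RowLe j k := by
      have := jsupp_pow_subset (RowLe j) (rowLe_add j) (zero_mem_rowLe j 0) hP k
      simpa using this
    have h2 : JSupp (Q ^ (e - k)) ⊆ RowLe j 0 := by
      have := jsupp_pow_subset (RowLe j) (rowLe_add j) (zero_mem_rowLe j 0) hQ (e - k)
      simpa using this
    have h3 := jsupp_mul_subset (RowLe j) (rowLe_add j)
      (jsupp_mul_subset (RowLe j) (rowLe_add j) h1 h2) (jsupp_natCast j (e.choose k))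
    intro x hx
    have := h3 hx
    simp only [add_zero, RowLe, Set.mem_setOf_eq] at this
    exact lt_of_le_of_lt this hk

/-- Product expansion with row budget. -/
theorem prod_expand (j : Fin d) {ι : Type*} (s : Finset ι) (P Q : ι → MvPolynomial (Var d) (A d))
    (e : ι → ℕ) (hP : ∀ i ∈ s, JSupp (P i) ⊆ RowLe j 1) (hQ : ∀ i ∈ s, JSupp (Q i) ⊆ RowLe j 0) :
    ∃ L, ∏ i ∈ s, (P i + Q i) ^ (e i) = ∏ i ∈ s, (P i) ^ (e i) + L ∧
      JSupp L ⊆ RowLt j (∑ i ∈ s, e i) := by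
  classical
  induction s using Finset.induction_on with
  | empty => exact ⟨0, by simp, by rw [jsupp_zero]; exact Set.empty_subset _⟩
  | insert i s hi ih =>
    obtain ⟨Ls, hLs, hLs'⟩ := ih (fun k hk => hP k (Finset.mem_insert_of_mem hk))
      (fun k hk => hQ k (Finset.mem_insert_of_mem hk))
    obtain ⟨Li, hLi, hLi'⟩ := binom_expand j (hP i (Finset.mem_insert_self i s))
      (hQ i (Finset.mem_insert_self i s)) (e i)
    refine ⟨P i ^ e i * Ls + Li * (∏ k ∈ s, P k ^ e k + Ls), ?_, ?_⟩
    · rw [Finset.prod_insert hi, Finset.prod_insert hi, hLs, hLi]; ring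
    · rw [Finset.sum_insert hi]
      have hA : JSupp (P i ^ e i) ⊆ RowLe j (e i) := by
        have := jsupp_pow_subset (RowLe j) (rowLe_add j) (zero_mem_rowLe j 0)
          (hP i (Finset.mem_insert_self i s)) (e i)
        simpa using this
      have hB : JSupp (∏ k ∈ s, P k ^ e k) ⊆ RowLe j (∑ k ∈ s, e k) := by
        have := jsupp_prod_subset s (RowLe j) (rowLe_add j) (zero_mem_rowLe j 0) (a := e)
          (P := fun k => P k ^ e k) fun k hk => by
            have := jsupp_pow_subset (RowLe j) (rowLe_add j) (zero_mem_rowLe j 0)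
              (hP k (Finset.mem_insert_of_mem hk)) (e k)
            simpa using this
        exact this
      refine (jsupp_add _ _).trans (Set.union_subset (jsupp_mul_rowLe_rowLt j hA hLs') ?_)
      refine jsupp_mul_rowLt_rowLe j hLi' ((jsupp_add _ _).trans (Set.union_subset hB ?_))
      exact hLs'.trans (rowLt_subset_rowLe j _)

/-- Landing hook of part 6: the level decomposition of the substitution. -/
theorem stub_pm_levelDecomposition : ∀ (d : ℕ) (j : Fin d) (hj : d ≤ 2 * (j : ℕ)) (u : Var d), u.col = j → lo j < u.row → sigmaX (Xmat d) u = Aterm j hj u + Rterm j u :=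
  fun _ j hj _ hu hq => sigmaX_level j hj hu hq

end Summit.MatrixMultiplication.MatrixMultiplication.Theorems.UnitriangularCostShape.ProductModel
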